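import Mathlib
import HarnessLib
import Summits.Ventures.LatticeQCDFlow.Exactness.NCMCGeneralSpaceGammaMethodConsistency

/-!
# DATA-DEPENDENT WINDOWS: scorer A's Γ-method variance `Γ̂_N(0) · 2 τ̂_{N,Ŵ_N}` stays consistent for EVERY measurable window rule `Ŵ_N(x)` bracketed by deterministic `W_N ≤ Ŵ_N ≤ W'_N` with `W_N → ∞`, `W'_N³/N → 0` — under a Doeblin power, from every initial law

HONEST FRAMING: exact (Metropolis-corrected) sampling algorithms for lattice gauge theory;
figures of merit are autocorrelation/cost numbers at stated couplings and volumes; no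
continuum-physics claim.

Venture `LatticeQCDFlow` (cell pub-lqcd), topic `Exactness`; FANOUT row 13 (`eng-snf`, GEN-20).
NEW WORK of the cell, not a published result; no definition is introduced; nothing is cited as a
fact.  Scorer A chooses its window from the data (Wolff's automatic rule, `Scoring/WolffWindow`);
`NCMCGeneralSpaceGammaMethodConsistency.lean` is stated at DETERMINISTIC windows.  THIS FILE is the
bridge that does not depend on the rule: whatever `Ŵ_N(x)` a scorer uses, if it is CLIPPED
to a deterministic bracket `W_N ≤ Ŵ_N(x) ≤ W'_N` with `W_N → ∞` and `W'_N³/N → 0`, the windowed variance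
statistic `Γ̂_N(0) + 2 Σ_{t<Ŵ_N(x)} Γ̂_N(t+1)` converges to `σ²_f` in probability from every initial law:
it differs from the `W_N`-statistic by at most `2 Σ_{W_N ≤ t < W'_N} |Γ̂_N(t+1)|`, whose MEAN is at most
`2 W'_N √(K(W'_N)/N) + 2 · (tail of the Doeblin envelope beyond W_N)` by the per-lag mean-square errors
(`NCMCGeneralSpaceGammaMethodMSE`, through `E|Y| ≤ √(E Y²)`) — `O(√(W'_N³/N))` plus a vanishing tail —
and Markov's inequality.

## Content

* `integral_abs_le_sqrt_integral_sq` — `E|Y| ≤ √(E Y²)` for bounded measurable `Y` on a probability space.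
* `chain_integral_abs_gammaHat_sub_le_of_nHit` — `E_{μ₀}|Γ̂_N(t) − C_f̄(t)| ≤ √(K(t)/N)`,
  `K(t) = C⁴(2112 + 1024t + 4224m/e + 512(m/e)²)`, `2t ≤ N`.
* `abs_gammaWindow_sub_gammaWindow_le` — `|σ̂²_{Ŵ} − σ̂²_{W}| ≤ 2 Σ_{W ≤ t < W'} |Γ̂(t+1)|` for
  `W ≤ Ŵ ≤ W'` (every path).
* **`chain_gammaDataWindow_tendstoInMeasure_of_nHit`** — THE THEOREM above.

NOT CLAIMED: that Wolff's automatic window satisfies a bracket (a scorer that wants the guarantee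
clips it); the optimal bracket; any number of ours.
-/

namespace Summit.Ventures.LatticeQCDFlow.Exactness.GeneralNCMC

open MeasureTheory ProbabilityTheory Set Filter Finset
open scoped ENNReal NNReal Topology

/-! ## §1 Lemmas -/

section Lemmas

/-- `E|Y| ≤ √(E Y²)` for a bounded measurable `Y` on a probability space. -/
theorem integral_abs_le_sqrt_integral_sq {Ω₀ : Type*} [MeasurableSpace Ω₀] (P : Measure Ω₀)
    [IsProbabilityMeasure P] {Y : Ω₀ → ℝ} (hY : Measurable Y) {B : ℝ} (hB : ∀ x, |Y x| ≤ B) :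
    ∫ x, |Y x| ∂P ≤ Real.sqrt (∫ x, Y x ^ 2 ∂P) := by
  have hmem : MemLp (fun x => |Y x|) 2 P :=
    MemLp.of_bound hY.abs.aestronglyMeasurable B (ae_of_all _ fun x => by
      rw [Real.norm_eq_abs, abs_abs]; exact hB x)
  have hvar := variance_nonneg (fun x => |Y x|) P
  rw [variance_eq_sub hmem] at hvar
  have hsq : ∫ x, ((fun x => |Y x|) ^ 2) x ∂P = ∫ x, Y x ^ 2 ∂P :=
    integral_congr_ae (ae_of_all _ fun x => by simp [sq_abs])
  rw [hsq] at hvar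
  refine Real.le_sqrt_of_sq_le ?_
  have : (∫ x, (fun x => |Y x|) x ∂P) = ∫ x, |Y x| ∂P := rfl
  linarith

/-- **Adjacent windows differ by the skipped lags**: for `W ≤ Ŵ ≤ W'`,
`|(Γ̂(0) + 2Σ_{t<Ŵ} Γ̂(t+1)) − (Γ̂(0) + 2Σ_{t<W} Γ̂(t+1))| ≤ 2 Σ_{t ∈ [W, W')} |Γ̂(t+1)|`. -/
theorem abs_gammaWindow_sub_gammaWindow_le (G : ℕ → ℝ) {W Wh W' : ℕ} (h1 : W ≤ Wh) (h2 : Wh ≤ W') :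
    |(G 0 + 2 * ∑ t ∈ range Wh, G (t + 1)) - (G 0 + 2 * ∑ t ∈ range W, G (t + 1))|
      ≤ 2 * ∑ t ∈ Finset.Ico W W', |G (t + 1)| := by
  rw [show (G 0 + 2 * ∑ t ∈ range Wh, G (t + 1)) - (G 0 + 2 * ∑ t ∈ range W, G (t + 1))
      = 2 * (∑ t ∈ range Wh, G (t + 1) - ∑ t ∈ range W, G (t + 1)) by ring,
    ← Finset.sum_Ico_eq_sub (fun t => G (t + 1)) h1, abs_mul, abs_two]
  refine mul_le_mul_of_nonneg_left ((Finset.abs_sum_le_sum_abs _ _).trans ?_) (by norm_num)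
  exact Finset.sum_le_sum_of_subset_of_nonneg (Finset.Ico_subset_Ico_right h2)
    fun t _ _ => abs_nonneg _

end Lemmas

/-! ## §2 The chain -/

section Chain

variable {S : Type*} [MeasurableSpace S]
  {κ : Kernel S S} [IsMarkovKernel κ] {π : Measure S} [IsProbabilityMeasure π]
  {ν : Measure S} [IsProbabilityMeasure ν] {ε : ℝ≥0∞} {m : ℕ}
  (μ₀ : Measure S) [IsProbabilityMeasure μ₀]

/-- `E_{μ₀}|Γ̂_N(t) − C_f̄(t)| ≤ √(K(t)/N)` for `2t ≤ N`, `0 < N`. -/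
theorem chain_integral_abs_gammaHat_sub_le_of_nHit
    (hmin : ∀ x {B : Set S}, MeasurableSet B → ε * ν B ≤ nHit κ m x B) (hε0 : 0 < ε) (hε1 : ε ≤ 1)
    (hm : 0 < m) (hπ : Kernel.Invariant κ π) {f : S → ℝ} (hf : Measurable f) {C : ℝ}
    (hC : ∀ x, |f x| ≤ C) {N t : ℕ} (htN : 2 * t ≤ N) (hN : 0 < N) :
    ∫ x, |Scoring.gammaHat (fun i => f (x i)) N t - Scoring.autocov κ π (fun y => f y - ∫ z, f z ∂π) t|
        ∂(Kernel.trajMeasure (X := fun _ : ℕ => S) μ₀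
        (fun n : ℕ => κ.comap (fun h : (i : ↥(Finset.Iic n)) → S => h ⟨n, Finset.mem_Iic.2 le_rfl⟩)
          (measurable_pi_apply _)))
      ≤ Real.sqrt (C ^ 4 * (2112 + 1024 * t + 4224 * m / ε.toReal + 512 * (m / ε.toReal) ^ 2) / N) := by
  have h := chain_mse_gammaHat_le_of_nHit μ₀ hmin hε0 hε1 hm hπ hf hC htN hN
  refine (integral_abs_le_sqrt_integral_sq _ ((measurable_gammaHat_comp hf N t).sub measurable_const)
    (B := (2 * C) ^ 2 + |Scoring.autocov κ π (fun y => f y - ∫ z, f z ∂π) t|)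
    (fun x => (abs_sub _ _).trans (add_le_add (abs_gammaHat_comp_le hC x N t) le_rfl))).trans ?_
  exact Real.sqrt_le_sqrt h

/-- **DATA-DEPENDENT (BRACKETED) WINDOWS KEEP THE Γ-METHOD VARIANCE CONSISTENT, FROM EVERY INITIAL
LAW.**  `κ` Markov, `π` invariant, `(nHit κ m)(z,·) ≥ ε ν` (`ε ≠ 0`, `0 < m`), `|f| ≤ C` measurable;
`Ŵ : ℕ → (ℕ → S) → ℕ` ANY window rule (no measurability needed: convergence in measure is an
outer-measure statement) with `W_N ≤ Ŵ N x ≤ W'_N` for all `x`, where `W_N → ∞` and `W'_N³/N → 0`.  Then for EVERY initial law `μ₀`,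
`Γ̂_N(0) + 2 Σ_{t<Ŵ_N(x)} Γ̂_N(t+1) → σ²_f` in `P_{μ₀}`-measure. -/
theorem chain_gammaDataWindow_tendstoInMeasure_of_nHit (hπ : Kernel.Invariant κ π)
    (hε : ε ≠ 0) (hmin : ∀ z, ε • ν ≤ nHit κ m z) (hm : 0 < m)
    {f : S → ℝ} (hf : Measurable f) {C : ℝ} (hC : ∀ x, |f x| ≤ C)
    {W W' : ℕ → ℕ} {Wh : ℕ → (ℕ → S) → ℕ}
    (hlo : ∀ N x, W N ≤ Wh N x) (hhi : ∀ N x, Wh N x ≤ W' N)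
    (hW : Tendsto W atTop atTop) (hW3 : Tendsto (fun N => (W' N : ℝ) ^ 3 / N) atTop (𝓝 0)) :
    TendstoInMeasure (Kernel.trajMeasure (X := fun _ : ℕ => S) μ₀
        (fun n : ℕ => κ.comap (fun h : (i : ↥(Finset.Iic n)) → S => h ⟨n, Finset.mem_Iic.2 le_rfl⟩)
          (measurable_pi_apply _)))
      (fun (N : ℕ) (x : ℕ → S) => Scoring.gammaHat (fun i => f (x i)) N 0
        + 2 * ∑ t ∈ range (Wh N x), Scoring.gammaHat (fun i => f (x i)) N (t + 1))
      atTop (fun _ => Scoring.autocov κ π (fun y => f y - ∫ z, f z ∂π) 0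
        + 2 * ∑' t, Scoring.autocov κ π (fun y => f y - ∫ z, f z ∂π) (t + 1)) := by
  set P := Kernel.trajMeasure (X := fun _ : ℕ => S) μ₀
      (fun n : ℕ => κ.comap (fun h : (i : ↥(Finset.Iic n)) → S => h ⟨n, Finset.mem_Iic.2 le_rfl⟩)
        (measurable_pi_apply _)) with hP
  haveI : Nonempty S := nonempty_of_isProbabilityMeasure μ₀
  have hε1 : ε ≤ 1 := by
    haveI := isMarkovKernel_nHit κ m
    exact eps_le_one_of_minorised hmin
  have hε0 : 0 < ε := pos_iff_ne_zero.2 hε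
  have hmin' : ∀ x {B : Set S}, MeasurableSet B → ε * ν B ≤ nHit κ m x B :=
    fun z B hB => minorised_setwise hmin z hB
  have hεtop : ε ≠ ∞ := ne_top_of_le_ne_top ENNReal.one_ne_top hε1
  have hεpos : 0 < ε.toReal := ENNReal.toReal_pos hε0.ne' hεtop
  have hr0 : 0 ≤ 1 - ε.toReal :=
    sub_nonneg.2 (ENNReal.toReal_le_of_le_ofReal zero_le_one (by simpa using hε1))
  have hr1 : 1 - ε.toReal < 1 := sub_lt_self _ hεpos
  have hC0 : 0 ≤ C := (abs_nonneg _).trans (hC (Classical.choice (nonempty_of_isProbabilityMeasure μ₀)))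
  set c := ∫ z, f z ∂π with hc
  set Cf : ℕ → ℝ := fun t => Scoring.autocov κ π (fun y => f y - c) t with hCf
  set σ2 := Cf 0 + 2 * ∑' t, Cf (t + 1) with hσ2
  -- the lower bracket: `W'_N ≥ W_N → ∞`, and `W_N³/N ≤ W'_N³/N → 0`
  have hW' : Tendsto W' atTop atTop :=
    tendsto_atTop_mono (fun N => (hlo N (fun _ => Classical.choice ‹Nonempty S›)).trans
      (hhi N _)) hW
  have hWW3 : Tendsto (fun N => (W N : ℝ) ^ 3 / N) atTop (𝓝 0) := by
    refine squeeze_zero (fun N => by positivity) (fun N => ?_) hW3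
    have hle : (W N : ℝ) ≤ W' N := by
      exact_mod_cast (hlo N (fun _ => Classical.choice ‹Nonempty S›)).trans (hhi N _)
    exact div_le_div_of_nonneg_right (pow_le_pow_left₀ (Nat.cast_nonneg (W N)) hle 3)
      (Nat.cast_nonneg N)
  -- the deterministic-window statistic converges
  have hdet := chain_gammaWindow_tendstoInMeasure_of_nHit μ₀ hmin' hε0 hε1 hm hπ hf hC hW hWW3
  rw [← hP] at hdet
  have hfunW : (fun (N : ℕ) (x : ℕ → S) => Scoring.gammaHat (fun i => f (x i)) N 0
        * (2 * Scoring.tauIntWindow (Scoring.rhoHat (fun i => f (x i)) N) (W N)))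
      = fun (N : ℕ) (x : ℕ → S) => Scoring.gammaHat (fun i => f (x i)) N 0
        + 2 * ∑ t ∈ range (W N), Scoring.gammaHat (fun i => f (x i)) N (t + 1) := by
    funext N x; exact (gammaWindow_eq_gammaHat_mul_tauIntWindow (fun i => f (x i)) N (W N)).symm
  rw [hfunW] at hdet
  -- the remainder `R_N = 2 Σ_{W_N ≤ t < W'_N} |Γ̂(t+1)|` has vanishing mean
  set K : ℕ → ℝ := fun t =>
    C ^ 4 * (2112 + 1024 * (t : ℝ) + 4224 * m / ε.toReal + 512 * (m / ε.toReal) ^ 2) with hKdef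
  have hC4 : 0 ≤ C ^ 4 := by positivity
  have hK0 : ∀ t, 0 ≤ K t := fun t => by simp only [hKdef]; positivity
  have hKmono : ∀ a b : ℕ, a ≤ b → K a ≤ K b := by
    intro a b hab
    have hab' : (a : ℝ) ≤ b := by exact_mod_cast hab
    simp only [hKdef]
    exact mul_le_mul_of_nonneg_left (by linarith) hC4
  set R : ℕ → (ℕ → S) → ℝ := fun N x =>
    2 * ∑ t ∈ Finset.Ico (W N) (W' N), |Scoring.gammaHat (fun i => f (x i)) N (t + 1)| with hR
  have hRm : ∀ N, Measurable (R N) := fun N =>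
    (Finset.measurable_sum _ fun t _ => (measurable_gammaHat_comp hf N (t + 1)).abs).const_mul 2
  have hR0 : ∀ N x, 0 ≤ R N x := fun N x =>
    mul_nonneg (by norm_num) (Finset.sum_nonneg fun t _ => abs_nonneg _)
  have hRb : ∀ N x, |R N x| ≤ 2 * (W' N * (2 * C) ^ 2) := fun N x => by
    rw [abs_of_nonneg (hR0 N x), hR]
    refine mul_le_mul_of_nonneg_left ?_ (by norm_num)
    calc ∑ t ∈ Finset.Ico (W N) (W' N), |Scoring.gammaHat (fun i => f (x i)) N (t + 1)|
        ≤ ∑ t ∈ Finset.Ico (W N) (W' N), (2 * C) ^ 2 :=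
          Finset.sum_le_sum fun t _ => abs_gammaHat_comp_le hC x N _
      _ = ((W' N - W N : ℕ) : ℝ) * (2 * C) ^ 2 := by
          rw [Finset.sum_const, Nat.card_Ico, nsmul_eq_mul]
      _ ≤ W' N * (2 * C) ^ 2 := by
          refine mul_le_mul_of_nonneg_right ?_ (by positivity)
          exact_mod_cast Nat.sub_le _ _
  -- the mean of `R_N` for `2 W'_N ≤ N`
  have hER : ∀ N, 2 * W' N ≤ N → 0 < N → ∫ x, R N x ∂P
      ≤ 2 * (W' N * Real.sqrt (K (W' N) / N))
        + 2 * (2 * (2 * C) ^ 2 * (m / ε.toReal) * (1 - ε.toReal) ^ ((W N + 1) / m)) := by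
    intro N hWN hN
    have hN' : (0 : ℝ) < N := by exact_mod_cast hN
    have hint : ∀ t, Integrable (fun x : ℕ → S => |Scoring.gammaHat (fun i => f (x i)) N (t + 1)|) P :=
      fun t => Scoring.integrable_of_bounded P (measurable_gammaHat_comp hf N (t + 1)).abs
        (C := (2 * C) ^ 2) fun x => by rw [abs_abs]; exact abs_gammaHat_comp_le hC x N _
    have hRN : ∫ x, R N x ∂P = 2 * ∑ t ∈ Finset.Ico (W N) (W' N),
        ∫ x, |Scoring.gammaHat (fun i => f (x i)) N (t + 1)| ∂P := by
      simp only [hR]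
      rw [integral_const_mul, integral_finsetSum _ fun t _ => hint t]
    rw [hRN, ← mul_add]
    refine mul_le_mul_of_nonneg_left ?_ (by norm_num)
    -- each term: `E|Γ̂(t+1)| ≤ E|Γ̂(t+1) − C(t+1)| + |C(t+1)| ≤ √(K(W')/N) + |C(t+1)|`
    have hterm : ∀ t ∈ Finset.Ico (W N) (W' N),
        ∫ x, |Scoring.gammaHat (fun i => f (x i)) N (t + 1)| ∂P
          ≤ Real.sqrt (K (W' N) / N) + |Cf (t + 1)| := by
      intro t ht
      have ht' : t + 1 ≤ W' N := (Finset.mem_Ico.1 ht).2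
      have hia : Integrable (fun x : ℕ → S =>
          |Scoring.gammaHat (fun i => f (x i)) N (t + 1) - Cf (t + 1)|) P :=
        Scoring.integrable_of_bounded P ((measurable_gammaHat_comp hf N (t + 1)).sub
          measurable_const).abs (C := (2 * C) ^ 2 + |Cf (t + 1)|) fun x => by
            rw [abs_abs]
            exact (abs_sub _ _).trans (add_le_add (abs_gammaHat_comp_le hC x N _) le_rfl)
      calc ∫ x, |Scoring.gammaHat (fun i => f (x i)) N (t + 1)| ∂P
          ≤ ∫ x, (|Scoring.gammaHat (fun i => f (x i)) N (t + 1) - Cf (t + 1)| + |Cf (t + 1)|) ∂P :=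
            integral_mono (hint t) (hia.add (integrable_const _)) fun x => by
              have := abs_add_le (Scoring.gammaHat (fun i => f (x i)) N (t + 1) - Cf (t + 1)) (Cf (t + 1))
              rwa [sub_add_cancel] at this
        _ = ∫ x, |Scoring.gammaHat (fun i => f (x i)) N (t + 1) - Cf (t + 1)| ∂P + |Cf (t + 1)| := by
            rw [integral_add hia (integrable_const _), integral_const, probReal_univ, one_smul]
        _ ≤ Real.sqrt (K (t + 1) / N) + |Cf (t + 1)| := by
            refine add_le_add ?_ le_rfl
            have h := chain_integral_abs_gammaHat_sub_le_of_nHit μ₀ hmin' hε0 hε1 hm hπ hf hC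
              (t := t + 1) (N := N) (by omega) hN
            rw [← hP] at h
            exact h
        _ ≤ Real.sqrt (K (W' N) / N) + |Cf (t + 1)| := by
            refine add_le_add (Real.sqrt_le_sqrt (div_le_div_of_nonneg_right (hKmono _ _ ht') hN'.le))
              le_rfl
    calc ∑ t ∈ Finset.Ico (W N) (W' N), ∫ x, |Scoring.gammaHat (fun i => f (x i)) N (t + 1)| ∂P
        ≤ ∑ t ∈ Finset.Ico (W N) (W' N), (Real.sqrt (K (W' N) / N) + |Cf (t + 1)|) :=
          Finset.sum_le_sum hterm
      _ = ((W' N - W N : ℕ) : ℝ) * Real.sqrt (K (W' N) / N)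
          + ∑ t ∈ Finset.Ico (W N) (W' N), |Cf (t + 1)| := by
          rw [Finset.sum_add_distrib, Finset.sum_const, Nat.card_Ico, nsmul_eq_mul]
      _ ≤ W' N * Real.sqrt (K (W' N) / N)
          + 2 * (2 * C) ^ 2 * (m / ε.toReal) * (1 - ε.toReal) ^ ((W N + 1) / m) := by
          refine add_le_add (mul_le_mul_of_nonneg_right (by exact_mod_cast Nat.sub_le _ _)
            (Real.sqrt_nonneg _)) ?_
          -- the envelope tail beyond `W_N`
          have hsumT : Summable fun t => |Cf (t + W N + 1)| := by
            have hs := summable_autocov_centred_succ_of_nHit hmin' hε0 hε1 hm hπ hf hC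
            have h := ((summable_nat_add_iff (W N)).2 hs).abs
            refine h.congr fun t => ?_
            show |Cf (t + W N + 1)| = |Cf (t + W N + 1)|
            rfl
          calc ∑ t ∈ Finset.Ico (W N) (W' N), |Cf (t + 1)|
              = ∑ j ∈ range (W' N - W N), |Cf (j + W N + 1)| := by
                rw [Finset.sum_Ico_eq_sum_range]
                exact Finset.sum_congr rfl fun j _ => by rw [Nat.add_comm (W N) j]
            _ ≤ ∑' j, |Cf (j + W N + 1)| :=
                hsumT.sum_le_tsum _ (fun j _ => abs_nonneg _)
            _ ≤ 2 * (2 * C) ^ 2 * (m / ε.toReal) * (1 - ε.toReal) ^ ((W N + 1) / m) :=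
                tsum_abs_autocov_shift_le_of_nHit hmin' hε0 hε1 hm hπ hf hC (W N)
  -- the bound on `E R_N` tends to zero
  have hbndR : Tendsto (fun N : ℕ => (2 * (W' N * Real.sqrt (K (W' N) / N))
        + 2 * (2 * (2 * C) ^ 2 * (m / ε.toReal) * (1 - ε.toReal) ^ ((W N + 1) / m)))) atTop (𝓝 0) := by
    have h1 : Tendsto (fun N : ℕ => (W' N : ℝ) * Real.sqrt (K (W' N) / N)) atTop (𝓝 0) := by
      -- `W' √(K(W')/N) = √(W'² K(W')/N)` and `W'² K(W') ≤ (K₀ + 1024 C⁴) W'³` once `W' ≥ 1`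
      have hK3 : Tendsto (fun N : ℕ => (C ^ 4 * (2112 + 4224 * m / ε.toReal + 512 * (m / ε.toReal) ^ 2)
          + 1024 * C ^ 4) * ((W' N : ℝ) ^ 3 / N)) atTop (𝓝 0) := by
        simpa using hW3.const_mul _
      have hsq : Tendsto (fun N : ℕ => Real.sqrt ((C ^ 4 * (2112 + 4224 * m / ε.toReal
          + 512 * (m / ε.toReal) ^ 2) + 1024 * C ^ 4) * ((W' N : ℝ) ^ 3 / N))) atTop (𝓝 0) := by
        simpa using hK3.sqrt
      refine squeeze_zero' (Eventually.of_forall fun N => by positivity) ?_ hsq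
      filter_upwards [hW'.eventually_ge_atTop 1] with N hN1
      have hW1 : (1 : ℝ) ≤ W' N := by exact_mod_cast hN1
      rw [show (W' N : ℝ) * Real.sqrt (K (W' N) / N) = Real.sqrt ((W' N : ℝ) ^ 2 * (K (W' N) / N)) by
        rw [Real.sqrt_mul' _ (div_nonneg (hK0 _) (Nat.cast_nonneg _)), Real.sqrt_sq (by positivity)]]
      refine Real.sqrt_le_sqrt ?_
      have hK0' : 0 ≤ C ^ 4 * (2112 + 4224 * m / ε.toReal + 512 * (m / ε.toReal) ^ 2) := by positivity
      have hW2 : (W' N : ℝ) ^ 2 ≤ (W' N : ℝ) ^ 3 := pow_le_pow_right₀ hW1 (by norm_num)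
      rw [show (W' N : ℝ) ^ 2 * (K (W' N) / N) = ((W' N : ℝ) ^ 2 * K (W' N)) / N by ring,
        show (C ^ 4 * (2112 + 4224 * m / ε.toReal + 512 * (m / ε.toReal) ^ 2) + 1024 * C ^ 4)
            * ((W' N : ℝ) ^ 3 / N)
          = ((C ^ 4 * (2112 + 4224 * m / ε.toReal + 512 * (m / ε.toReal) ^ 2) + 1024 * C ^ 4)
            * (W' N : ℝ) ^ 3) / N by ring]
      refine div_le_div_of_nonneg_right ?_ (by positivity)
      simp only [hKdef]
      nlinarith [mul_le_mul_of_nonneg_left hW2 hK0', hC4]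
    have h2 : Tendsto (fun N : ℕ => 2 * (2 * C) ^ 2 * (m / ε.toReal) * (1 - ε.toReal) ^ ((W N + 1) / m))
        atTop (𝓝 0) := by
      have hq : Tendsto (fun N : ℕ => (W N + 1) / m) atTop atTop :=
        (Nat.tendsto_div_const_atTop hm.ne').comp ((Filter.tendsto_add_atTop_nat 1).comp hW)
      simpa using ((tendsto_pow_atTop_nhds_zero_of_lt_one hr0 hr1).comp hq).const_mul
        (2 * (2 * C) ^ 2 * (m / ε.toReal))
    simpa using (h1.const_mul 2).add (h2.const_mul 2)
  -- `R_N → 0` in probability (Markov)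
  have hRconv : TendstoInMeasure P R atTop (fun _ => (0 : ℝ)) := by
    rw [tendstoInMeasure_iff_measureReal_norm]
    intro δ hδ
    have hev : ∀ᶠ N in atTop, 2 * W' N ≤ N ∧ 0 < N := by
      have hsmall : ∀ᶠ N in atTop, (W' N : ℝ) ^ 3 / N < 1 / 2 := (tendsto_order.1 hW3).2 _ (by norm_num)
      filter_upwards [hsmall, hW'.eventually_ge_atTop 1, Filter.eventually_gt_atTop 0] with N h1 h2 h3
      refine ⟨?_, h3⟩
      have hN' : (0 : ℝ) < N := by exact_mod_cast h3
      have hW1 : (1 : ℝ) ≤ W' N := by exact_mod_cast h2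
      have hle : (W' N : ℝ) ≤ (W' N : ℝ) ^ 3 := by
        have h := pow_le_pow_right₀ hW1 (show 1 ≤ 3 by norm_num)
        rwa [pow_one] at h
      have h4 : (W' N : ℝ) / N < 1 / 2 := lt_of_le_of_lt (div_le_div_of_nonneg_right hle hN'.le) h1
      rw [div_lt_iff₀ hN'] at h4
      have : (2 * W' N : ℕ) < (N : ℝ) + 1 := by push_cast; linarith
      exact_mod_cast Nat.lt_succ_iff.1 (by exact_mod_cast this)
    have hb0 := hbndR.div_const δ
    rw [zero_div] at hb0
    refine squeeze_zero' (Eventually.of_forall fun n => measureReal_nonneg) ?_ hb0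
    filter_upwards [hev] with N hN
    have hiR : Integrable (R N) P := Scoring.integrable_of_bounded P (hRm N) (hRb N)
    have hmk := mul_meas_ge_le_integral_of_nonneg (μ := P) (ae_of_all _ fun x => hR0 N x) hiR δ
    have hset : {x : ℕ → S | δ ≤ ‖R N x - 0‖} = {x | δ ≤ R N x} := by
      ext x; simp only [Set.mem_setOf_eq, sub_zero, Real.norm_eq_abs, abs_of_nonneg (hR0 N x)]
    rw [hset]
    calc P.real {x | δ ≤ R N x} ≤ (∫ x, R N x ∂P) / δ := by
          rw [le_div_iff₀ hδ, mul_comm]; exact hmk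
      _ ≤ _ := div_le_div_of_nonneg_right (hER N hN.1 hN.2) hδ.le
  -- combine: `{δ ≤ d(σ̂²_Ŵ, σ²)} ⊆ {δ/2 ≤ d(σ̂²_W, σ²)} ∪ {δ/2 ≤ R_N}`
  intro δ hδ
  have hδ2 : (0 : ℝ≥0∞) < δ / 2 := ENNReal.half_pos hδ.ne'
  have hA := hdet (δ / 2) hδ2
  have hB := hRconv (δ / 2) hδ2
  have h0 : Tendsto (fun N => P {x | δ / 2 ≤ edist (Scoring.gammaHat (fun i => f (x i)) N 0
        + 2 * ∑ t ∈ range (W N), Scoring.gammaHat (fun i => f (x i)) N (t + 1)) σ2}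
      + P {x | δ / 2 ≤ edist (R N x) 0}) atTop (𝓝 0) := by
    simpa using hA.add hB
  refine tendsto_of_tendsto_of_tendsto_of_le_of_le tendsto_const_nhds h0 (fun N => bot_le) fun N => ?_
  refine (measure_mono fun x hx => ?_).trans (measure_union_le _ _)
  simp only [Set.mem_setOf_eq, Set.mem_union] at hx ⊢
  by_contra hcon
  rw [not_or, not_le, not_le] at hcon
  have hdiff : edist (Scoring.gammaHat (fun i => f (x i)) N 0
          + 2 * ∑ t ∈ range (Wh N x), Scoring.gammaHat (fun i => f (x i)) N (t + 1))
          (Scoring.gammaHat (fun i => f (x i)) N 0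
          + 2 * ∑ t ∈ range (W N), Scoring.gammaHat (fun i => f (x i)) N (t + 1))
      ≤ edist (R N x) 0 := by
    rw [edist_dist, edist_dist, Real.dist_eq, Real.dist_eq, sub_zero, abs_of_nonneg (hR0 N x)]
    exact ENNReal.ofReal_le_ofReal
      (abs_gammaWindow_sub_gammaWindow_le (fun t => Scoring.gammaHat (fun i => f (x i)) N t)
        (hlo N x) (hhi N x))
  have hlt : edist (Scoring.gammaHat (fun i => f (x i)) N 0
        + 2 * ∑ t ∈ range (Wh N x), Scoring.gammaHat (fun i => f (x i)) N (t + 1)) σ2 < δ :=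
    calc edist (Scoring.gammaHat (fun i => f (x i)) N 0
            + 2 * ∑ t ∈ range (Wh N x), Scoring.gammaHat (fun i => f (x i)) N (t + 1)) σ2
          ≤ edist (Scoring.gammaHat (fun i => f (x i)) N 0
              + 2 * ∑ t ∈ range (Wh N x), Scoring.gammaHat (fun i => f (x i)) N (t + 1))
              (Scoring.gammaHat (fun i => f (x i)) N 0
              + 2 * ∑ t ∈ range (W N), Scoring.gammaHat (fun i => f (x i)) N (t + 1))
            + edist (Scoring.gammaHat (fun i => f (x i)) N 0
              + 2 * ∑ t ∈ range (W N), Scoring.gammaHat (fun i => f (x i)) N (t + 1)) σ2 :=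
            edist_triangle _ _ _
      _ ≤ edist (R N x) 0 + edist (Scoring.gammaHat (fun i => f (x i)) N 0
              + 2 * ∑ t ∈ range (W N), Scoring.gammaHat (fun i => f (x i)) N (t + 1)) σ2 :=
            add_le_add hdiff le_rfl
      _ < δ / 2 + δ / 2 := ENNReal.add_lt_add hcon.2 hcon.1
      _ = δ := ENNReal.add_halves δ
  exact absurd hx (not_le.2 hlt)

end Chain

end Summit.Ventures.LatticeQCDFlow.Exactness.GeneralNCMC
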